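import Summits.BirchSwinnertonDyer.BirchSwinnertonDyer.Theorems.KimAtThreeShallowEqDeepGoodCoreVertex
import Summits.BirchSwinnertonDyer.Rank1Residual.GaloisImage.KolyvaginBaseRigidityDeep
import Summits.BirchSwinnertonDyer.Rank1Residual.GaloisImage.KolyvaginDeepLedger
import Summits.BirchSwinnertonDyer.Rank1Residual.GaloisImage.EPCTateFormula
import Literature.NumberTheory.Automorphic.AdicCompletionLocalField
import HarnessLib

/-!
# Route `KimAtThreeKolyvagin` (rung W2), crux `ShallowEqDeepAtTorsionFree` (item
# stmt-BirchSwinnertonDyer-19077): good core vertices over `ℚ` at `p = 3` on the DEEP classes of the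
# `3`-adic tower (local shapes discharged), and the `hinj` clause of the END core at every depth from the
# vanishing of the level-`d` Kummer Selmer group

Cell `bsd-addord`, seat `bsd-addord-w2-c4` (D-0074 row B7), gen 3; sibling of
`KimAtThreeShallowEqDeepGoodCoreVertex` (the abstract `χ = 0` killing with size bound and its `E[p]`
reading).  TOOL theorems only (no definition, no named fact, no `sorry`); nothing asserted about any
particular curve; nothing booked; no mark moved.

## What

* §4 **`exists_superset_kummerSelmerGroup_eq_bot_rat_three_deep`** / `exists_level_…`: `E/ℚ` with
  `ρ̄_{E,3}` onto, `Sel^{(3)}(E/ℚ)` finite, `S ⊇ ∞ ∪ {3} ∪ {bad}`, a Kolyvagin datum on `E[3]` whose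
  primes are Sakamoto's class of `τ` on `E[3^{k′+1}]` (`frobeniusClassPrimes (E[3^{k′}·3]) {v ∈ S} τ 3^{k′+1}`)
  with cyclotomic transverse conditions, `τ ∈ Gal(ℚ̄/ℚ(μ_{3^{k′+1}}))`, `E[3]/(τ − 1) ≃ ℤ/3` (ONE such
  `τ` serves all depths under the tower: n1011 `S24Deep.exists_tau_forall_levels_of_towerSurj`) ⟹ a
  level `d` above any given one with `H¹_{𝓚(d)}(ℚ, E[3]) = 0 = H¹_{𝓚(d)^*}` and, from the empty
  level, `3^{#d} ∣ #Sel^{(3)}(E/ℚ)` — a size bound INDEPENDENT OF THE DEPTH `k′`.  Discharged by n1011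
  theorems: Rubin's local shapes at the primes (through `S24Deep.frobeniusClassPrimes_mono`), `𝓚`
  unramified outside `S`, (H.3) on the deep group (`hH3_three_pow_of_irr`), `ker ρ_{E[3^{k′+1}]} ≤ ker ρ̄`,
  Tate's local Euler characteristic (`EPCTate.localEulerPoincareCharacteristic`).
* §5 `apply_localization_eq_zero_iff_mem_kummer_atLevel` (level-`d` form of n1011's
  `DeepLedger.apply_localization_eq_zero_iff_mem_kummer`) and
  **`localization_injOn_atLevel_of_kummer_atLevel_eq_bot`**: at every depth `k`, for the dictionary
  functional `Λ` with the DICT3 kernel clause, `H¹_{𝓚(d)}(ℚ, E[p^{k+1}]) = 0` at a level `d ∌ v_p` ⟹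
  `Λ ∘ loc_{v_p}` injective on `H¹_{𝓕_can(d)}(ℚ, E[p^{k+1}])` — VERBATIM the `hinj` of
  `KimAtThreeDeepUpperEndCore.EndCore.exists_certificate_of_witnessAt` (w2-c3).

## Status of the GOOD CORE VERTEX port after these two files

At the residual level (`k = 0`): the vertex EXISTS with `#d ≤ dim Sel^{(3)}(E/ℚ)` and `hinj` (§4 + §5,
once `E[3^0·3]` is read as `E[3]`).  At depth `k ≥ 1`: §4 still supplies the level `d` (primes of the
depth-`k+1` class, same bound); what remains is the dévissage `H¹_{𝓚̄(d)}(ℚ, E[3]) = 0 ⟹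
H¹_{𝓚(d)}(ℚ, E[3^{k+1}]) = 0` (Mazur–Rubin Lemma 3.5.3: `H¹(ℚ, E[3]) ↠ H¹(ℚ, E[3^{k+1}])[3]` as
`E[3]` is irreducible, plus the cartesian property of the Kummer and transverse conditions), and `hord`
from [S24] Thm. 4.4 (1)'s bijectivity clause.  No crux is proved; nothing booked.

References: [Rubin2011] Prop. 1.9.5, Cor. 2.6.2, Prop. 2.7.1, Cor. 2.7.3; [MazurRubin2004] Prop. 2.3.5,
Prop. 3.6.1, Lemma 3.5.3, Cor. 4.1.9; [Sakamoto2024] Lemma 5.2, Cor. 5.5; [Kim2022StructureSelmer]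
Prop. 3.12; [MilneADT2006] I Thm. 2.8.
-/

set_option autoImplicit false
-- the Theorems namespace of a single-conjunct summit repeats the summit name by design (D-0017)
set_option linter.dupNamespace false

noncomputable section

open scoped Classical NumberField ContRepresentation
open Function Field NumberField IsDedekindDomain
open Literature.NumberTheory.GaloisRepresentations Literature.NumberTheory.GaloisRepresentations.DiscreteGaloisModule
  Literature.NumberTheory.GaloisCohomology
open Summit.BirchSwinnertonDyer.Rank1Residual.GaloisImage
open Summit.BirchSwinnertonDyer.Rank1Residual.GaloisImage.CoreRankZero
open Summit.BirchSwinnertonDyer.Rank1Residual.X11b.Levels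

namespace Summit.BirchSwinnertonDyer.BirchSwinnertonDyer.Theorems.KimAtThreeShallowEqDeepGoodCoreVertex

/-! ## §4. `p = 3` over `ℚ`: the residual Kummer structure on a DEEP class of the `3`-adic tower, local
shapes discharged -/

section RatThree

open WeierstrassCurve Literature.NumberTheory.EllipticCurves
open Summit.BirchSwinnertonDyer.Rank1Residual.X11b.LocBridge

variable (W : WeierstrassCurve ℚ) [W.IsElliptic]

/-- **Good core vertices of bounded size for `(E[3], 𝓚, 𝒫)` over `ℚ` on the DEEP class of depth
`k′ + 1`** — the datum's primes are Sakamoto's class of `τ` read on `E[3^{k′+1}]`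
(`frobeniusClassPrimes (E[3^{k′}·3]) {v | v ∈ S} τ 3^{k′+1}`: `ℓ ∉ S`, `ℓ ≡ 1 (mod 3^{k′+1})`,
`Frob_ℓ ~ τ` on `E[3^{k′+1}]`), its transverse conditions cyclotomic; `ρ̄_{E,3}` onto; `τ` fixes
`μ_{3^{k′+1}}` and `E[3]/(τ − 1) ≃ ℤ/3` (for ONE `τ` at all depths under the tower:
n1011 `S24Deep.exists_tau_forall_levels_of_towerSurj`); `S ⊇ ∞ ∪ {3} ∪ {bad}`; `Sel^{(3)}(E/ℚ)` finite.
THEN above every level `n` of the datum there is a level `d ⊇ n` with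
`H¹_{𝓚(d)}(ℚ, E[3]) = 0 = H¹_{𝓚(d)^*}(ℚ, E[3]^D)` and `3^{#d} ∣ 3^{#n} · #H¹_{𝓚(n)^*}`.  DISCHARGED
here (n1011 theorems): the local shapes at the primes (`absNorm_sub_one_smul_eq_zero_…`,
`natCard_unramifiedSubgroup_toLocal_…`, `natCard_cyclotomicTransverse_rat_…'`,
`unramifiedSubgroup_sup_cyclotomicTransverse_eq_top_…` through `S24Deep.frobeniusClassPrimes_mono`),
`𝓚` unramified outside `S` (X11b `kummerSelmerStructure_isUnramifiedOutside`), (H.3) on the deep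
group (`hH3_three_pow_of_irr`), `ker ρ_{E[3^{k′+1}]} ≤ ker ρ̄` (`S24Deep.torsionGaloisModule_eq_one_of_dvd`),
Tate's local Euler characteristic (`EPCTate.localEulerPoincareCharacteristic`).  Binders left: the
Poitou–Tate family (`poitouTate_selmerStructure_duality ℚ` provides one), `τ` with its two
properties, `S`, finiteness of `Sel^{(3)}`.
[cite: Rubin2011, Cor. 2.6.2 (4), Prop. 2.7.1, Cor. 2.7.3 (pp. 22–24)] [cite: MazurRubin2004, Prop. 3.6.1, Cor. 4.1.9]
[cite: Sakamoto2024, Lemma 5.2 and Cor. 5.5 (pp. 928–929)] -/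
theorem exists_superset_kummerSelmerGroup_eq_bot_rat_three_deep
    [Finite (geomTorsion W ((3 : ℕ) : ℤ))]
    (h3 : W.HasSurjectiveModNGaloisRep ((3 : ℕ) : ℤ)) (k' : ℕ)
    (τ : absoluteGaloisGroup ℚ) (hτμ : τ ∈ rootsOfUnityFixer ℚ (3 ^ (k' + 1)))
    (hτq : Nonempty (cokerSubOne (W.torsionGaloisModule ((3 : ℕ) : ℤ)) τ ≃+ ZMod 3))
    (inv : LocalInvariants ℚ 3) (hperf : inv.IsPerfect) (hsum : inv.SumLocalTermEqZero)
    (hcompl : inv.SelmerComplement)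
    (S : Finset (Place ℚ)) (hS : ∀ w : InfinitePlace ℚ, (Sum.inl w : Place ℚ) ∈ S)
    (h3S : ∀ v : HeightOneSpectrum (𝓞 ℚ), ((3 : ℕ) : 𝓞 ℚ) ∈ v.asIdeal → (Sum.inr v : Place ℚ) ∈ S)
    (hbadS : ∀ v : HeightOneSpectrum (𝓞 ℚ), ¬ W.HasGoodReductionAt v → (Sum.inr v : Place ℚ) ∈ S)
    [hfin : Finite (W.kummerSelmerStructure ((3 : ℕ) : ℤ)).selmerGroup]
    (D : KolyvaginDatum (W.torsionGaloisModule ((3 : ℕ) : ℤ)))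
    (hP : D.primes = frobeniusClassPrimes (W.torsionGaloisModule (((3 : ℕ) : ℤ) ^ k' * ((3 : ℕ) : ℤ)))
      {v | (Sum.inr v : Place ℚ) ∈ S} τ (3 ^ (k' + 1)))
    (hT : D.transverse = cyclotomicTransverse (W.torsionGaloisModule ((3 : ℕ) : ℤ)))
    {n : Finset (HeightOneSpectrum (𝓞 ℚ))} (hn : D.IsLevel n) :
    ∃ d, n ⊆ d ∧ D.IsLevel d ∧
      (inv.dualSelmerStructure (W.torsionGaloisModule ((3 : ℕ) : ℤ))
        (D.atLevel (W.kummerSelmerStructure ((3 : ℕ) : ℤ)) d)).selmerGroup = ⊥ ∧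
      (D.atLevel (W.kummerSelmerStructure ((3 : ℕ) : ℤ)) d).selmerGroup = ⊥ ∧
      3 ^ d.card ∣ 3 ^ n.card * Nat.card (inv.dualSelmerStructure (W.torsionGaloisModule ((3 : ℕ) : ℤ))
        (D.atLevel (W.kummerSelmerStructure ((3 : ℕ) : ℤ)) n)).selmerGroup := by
  haveI : Fact (Nat.Prime 3) := ⟨Nat.prime_three⟩
  haveI : Finite (geomTorsion W (((3 : ℕ) : ℤ) ^ k' * ((3 : ℕ) : ℤ))) := finite_geomTorsion_pow_mul W 3 k'
  have hM : ∀ m : geomTorsion W ((3 : ℕ) : ℤ), (3 : ℕ) • m = 0 := fun T => AddSubgroup.torsionBy.nsmul T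
  have hdvd : 3 ∣ 3 ^ (k' + 1) := dvd_pow_self 3 (Nat.succ_ne_zero k')
  have hτμ3 : τ ∈ rootsOfUnityFixer ℚ 3 := rootsOfUnityFixer_le_of_dvd ℚ hdvd hτμ
  have hker : ∀ u : absoluteGaloisGroup ℚ,
      W.torsionGaloisModule (((3 : ℕ) : ℤ) ^ k' * ((3 : ℕ) : ℤ)) u = 1 →
        W.torsionGaloisModule ((3 : ℕ) : ℤ) u = 1 :=
    fun u hu => S24Deep.torsionGaloisModule_eq_one_of_dvd W (Dvd.intro_left _ rfl) u hu
  -- the primes of the datum lie in the level-`3` class of `E[3]` and outside `S`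
  have hmono : ∀ q ∈ D.primes, q ∈ frobeniusClassPrimes (W.torsionGaloisModule ((3 : ℕ) : ℤ))
      {v | (Sum.inr v : Place ℚ) ∈ S} τ 3 := fun q hq =>
    S24Deep.frobeniusClassPrimes_mono (W.torsionGaloisModule ((3 : ℕ) : ℤ)) _ hker _ τ hdvd (hP ▸ hq)
  have hPS : ∀ q ∈ D.primes, (Sum.inr q : Place ℚ) ∉ S := fun q hq => (hmono q hq).1
  -- the local shape at the Kolyvagin primes (Rubin Prop. 1.9.5 (1) / Ex. 1.9.7)
  have hprime : ∀ q : HeightOneSpectrum (𝓞 ℚ), Fact (Ideal.absNorm q.asIdeal).Prime :=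
    fun q => ⟨FSComp.prime_absNorm_rat q⟩
  have hne : ∀ q : HeightOneSpectrum (𝓞 ℚ),
      NeZero ((Ideal.absNorm q.asIdeal : ℕ) : q.adicCompletion ℚ) := fun q => by
    haveI : CharZero (q.adicCompletion ℚ) :=
      charZero_of_injective_algebraMap (algebraMap ℚ (q.adicCompletion ℚ)).injective
    exact ⟨Nat.cast_ne_zero.2 (FSComp.prime_absNorm_rat q).ne_zero⟩
  have hM' : ∀ q ∈ D.primes, ∀ m : geomTorsion W ((3 : ℕ) : ℤ), (Ideal.absNorm q.asIdeal - 1) • m = 0 :=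
    fun q hq => absNorm_sub_one_smul_eq_zero_of_mem_frobeniusClassPrimes _ (hmono q hq) hτμ3 hM
  have hU : ∀ q ∈ D.primes,
      Nat.card (unramifiedSubgroup (GaloisRep.toLocal q (W.torsionGaloisModule ((3 : ℕ) : ℤ))) 1) = 3 :=
    fun q hq => natCard_unramifiedSubgroup_toLocal_of_mem_frobeniusClassPrimes _ (hmono q hq) hτq
  have hT' : ∀ q ∈ D.primes, Nat.card (D.transverse (Sum.inr q)) = 3 := fun q hq => by
    haveI := hprime q; haveI := hne q
    rw [hT]
    exact natCard_cyclotomicTransverse_rat_of_mem_frobeniusClassPrimes' _ (hmono q hq) hτq (hM' q hq)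
  have hUT : ∀ q ∈ D.primes,
      unramifiedSubgroup (GaloisRep.toLocal q (W.torsionGaloisModule ((3 : ℕ) : ℤ))) 1 ⊔
        D.transverse (Sum.inr q) = ⊤ := fun q hq => by
    haveI := hprime q; haveI := hne q
    rw [hT]
    exact unramifiedSubgroup_sup_cyclotomicTransverse_eq_top_of_mem_frobeniusClassPrimes _ (hmono q hq)
      (hM' q hq) (modPCyclotomicCharacter_surjOn_absInertia_rat_holds q)
  -- `𝓚` unramified outside `S`; Tate's local Euler characteristic; (H.3) on the deep group
  have h𝓚 : (W.kummerSelmerStructure ((3 : ℕ) : ℤ)).IsUnramifiedOutside S := by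
    have hK := Summit.BirchSwinnertonDyer.Rank1Residual.X11b.KummerDuality.kummerSelmerStructure_isUnramifiedOutside W 3 1 S
      hS h3S hbadS
    rwa [pow_one] at hK
  have hEP : ∀ v : HeightOneSpectrum (𝓞 ℚ), localEulerPoincareCharacteristic (v.adicCompletion ℚ) :=
    fun v =>
      haveI : CharZero (v.adicCompletion ℚ) :=
        charZero_of_injective_algebraMap (algebraMap ℚ (v.adicCompletion ℚ)).injective
      EPCTate.localEulerPoincareCharacteristic (v.adicCompletion ℚ)
  have hSfin : {v : HeightOneSpectrum (𝓞 ℚ) | (Sum.inr v : Place ℚ) ∈ S}.Finite :=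
    S.finite_toSet.preimage Sum.inr_injective.injOn
  exact exists_superset_kummerSelmerGroup_eq_bot_of_deepClass W 3 (by decide) h3 hperf hsum hcompl hEP
    (fun v hv => not_mem_and_isUnramifiedAt_three_of_not_mem W S h3S hbadS hv) h𝓚 hPS hU hT' hUT
    (W.torsionGaloisModule (((3 : ℕ) : ℤ) ^ k' * ((3 : ℕ) : ℤ))) hker hSfin
    (pow_ne_zero _ three_ne_zero) hP hτq
    (hH3_three_pow_of_irr W (hasIrreducibleModPGaloisRep_of_hasSurjectiveModNGaloisRep W 3 h3) k') hn

/-- **From the empty level, with the bound on the `3`-Selmer group**: for every depth `k′` and every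
such datum there is a level `d` with `H¹_{𝓚(d)}(ℚ, E[3]) = 0 = H¹_{𝓚(d)^*}(ℚ, E[3]^D)` and
`3^{#d} ∣ #Sel^{(3)}(E/ℚ)` — at most `dim_{𝔽₃} Sel^{(3)}(E/ℚ)` Kolyvagin primes `ℓ ≡ 1 (mod 3^{k′+1})`
of the class of `τ`, a bound INDEPENDENT OF THE DEPTH. [cite: Rubin2011, Cor. 2.7.3 (p. 24)]
[cite: MazurRubin2004, Prop. 3.6.1, Cor. 4.1.9] [cite: Sakamoto2024, Cor. 5.5 (p. 929)] -/
theorem exists_level_kummerSelmerGroup_eq_bot_rat_three_deep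
    [Finite (geomTorsion W ((3 : ℕ) : ℤ))]
    (h3 : W.HasSurjectiveModNGaloisRep ((3 : ℕ) : ℤ)) (k' : ℕ)
    (τ : absoluteGaloisGroup ℚ) (hτμ : τ ∈ rootsOfUnityFixer ℚ (3 ^ (k' + 1)))
    (hτq : Nonempty (cokerSubOne (W.torsionGaloisModule ((3 : ℕ) : ℤ)) τ ≃+ ZMod 3))
    (inv : LocalInvariants ℚ 3) (hperf : inv.IsPerfect) (hsum : inv.SumLocalTermEqZero)
    (hcompl : inv.SelmerComplement)
    (S : Finset (Place ℚ)) (hS : ∀ w : InfinitePlace ℚ, (Sum.inl w : Place ℚ) ∈ S)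
    (h3S : ∀ v : HeightOneSpectrum (𝓞 ℚ), ((3 : ℕ) : 𝓞 ℚ) ∈ v.asIdeal → (Sum.inr v : Place ℚ) ∈ S)
    (hbadS : ∀ v : HeightOneSpectrum (𝓞 ℚ), ¬ W.HasGoodReductionAt v → (Sum.inr v : Place ℚ) ∈ S)
    [hfin : Finite (W.kummerSelmerStructure ((3 : ℕ) : ℤ)).selmerGroup]
    (D : KolyvaginDatum (W.torsionGaloisModule ((3 : ℕ) : ℤ)))
    (hP : D.primes = frobeniusClassPrimes (W.torsionGaloisModule (((3 : ℕ) : ℤ) ^ k' * ((3 : ℕ) : ℤ)))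
      {v | (Sum.inr v : Place ℚ) ∈ S} τ (3 ^ (k' + 1)))
    (hT : D.transverse = cyclotomicTransverse (W.torsionGaloisModule ((3 : ℕ) : ℤ))) :
    ∃ d, D.IsLevel d ∧
      (inv.dualSelmerStructure (W.torsionGaloisModule ((3 : ℕ) : ℤ))
        (D.atLevel (W.kummerSelmerStructure ((3 : ℕ) : ℤ)) d)).selmerGroup = ⊥ ∧
      (D.atLevel (W.kummerSelmerStructure ((3 : ℕ) : ℤ)) d).selmerGroup = ⊥ ∧
      3 ^ d.card ∣ Nat.card (W.kummerSelmerStructure ((3 : ℕ) : ℤ)).selmerGroup := by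
  haveI : Fact (Nat.Prime 3) := ⟨Nat.prime_three⟩
  obtain ⟨d, -, hd, hbot, hbot', hdiv⟩ := exists_superset_kummerSelmerGroup_eq_bot_rat_three_deep W h3 k'
    τ hτμ hτq inv hperf hsum hcompl S hS h3S hbadS D hP hT D.isLevel_empty
  refine ⟨d, hd, hbot, hbot', ?_⟩
  obtain ⟨e, hμ, hadd₁, hadd₂, halt, hnondeg, hgal⟩ :=
    exists_weilPairing_holds W 3 (by norm_num) (by norm_num)
  have hinv : ∀ v : HeightOneSpectrum (𝓞 ℚ), Injective (inv (Sum.inr v)) := fun v => (hperf v).1.1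
  have hEP : ∀ v : HeightOneSpectrum (𝓞 ℚ), localEulerPoincareCharacteristic (v.adicCompletion ℚ) :=
    fun v =>
      haveI : CharZero (v.adicCompletion ℚ) :=
        charZero_of_injective_algebraMap (algebraMap ℚ (v.adicCompletion ℚ)).injective
      EPCTate.localEulerPoincareCharacteristic (v.adicCompletion ℚ)
  have hcount := natCard_selmerGroup_kummer_eq_dual W 3 e hμ hadd₁ hadd₂ hgal halt hnondeg
    Nat.prime_three.isPrimePow (by decide) inv hinv hEP
  have h0 : D.atLevel (W.kummerSelmerStructure ((3 : ℕ) : ℤ)) ∅ = W.kummerSelmerStructure ((3 : ℕ) : ℤ) :=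
    SelmerStructure.modify_empty _ D.transverse
  rw [Finset.card_empty, pow_zero, one_mul, h0] at hdiv
  exact hcount ▸ hdiv

end RatThree

/-! ## §5. At every depth: `Λ ∘ loc₃` is injective on `H¹_{𝓕_can(d)}(ℚ, E[p^{k+1}])` as soon as
`H¹_{𝓚(d)}(ℚ, E[p^{k+1}]) = 0` — the `hinj` clause of `KimAtThreeDeepUpperEndCore` -/

section Depth

open WeierstrassCurve Literature.NumberTheory.EllipticCurves

variable (W : WeierstrassCurve ℚ) [W.IsElliptic] (p : ℕ) [hp : Fact p.Prime] (k : ℕ)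

/-- **`ker(Λ ∘ loc_{v_p}) ∩ H¹_{𝓕_can(d)} = H¹_{𝓚(d)}` at every level `d ∌ v_p`** (the level-`d`
form of n1011's `DeepLedger.apply_localization_eq_zero_iff_mem_kummer`): for `x` in the level-`d`
propagated Selmer group, `Λ(loc_{v_p} x) = 0` iff `x` lies in the level-`d` Kummer Selmer group — at
`v_p` by the kernel clause of the dictionary functional (`hker`, as in DICT3 / `KatoKuriharaWitnessAt`),
at the primes of `d` because both structures carry the datum's transverse condition, at the other
finite places because `𝓕_can,v = 𝓚_v` (`propagatedSelmerStructure_inr_eq_kummerSelmerStructure`),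
at the infinite place because `H¹(ℝ, E[p^{k+1}]) = 0` (`p` odd).
[cite: Kim2022StructureSelmer, Prop. 3.12 and §3.4.1] [cite: MazurRubin2004, Prop. 2.3.5] -/
theorem apply_localization_eq_zero_iff_mem_kummer_atLevel (hp2 : p ≠ 2)
    {v₀ : HeightOneSpectrum (𝓞 ℚ)} (hv₀ : ((p : ℕ) : 𝓞 ℚ) ∈ v₀.asIdeal)
    (Λ : galoisCohomology ((W.torsionGaloisModule ((p : ℤ) ^ k * (p : ℤ))).toLocal (Sum.inr v₀)) 1
      →+ ZMod (p ^ (k + 1)))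
    (hker : ∀ x ∈ propagatedSelmerStructure W p k (Sum.inr v₀),
      Λ x = 0 ↔ x ∈ W.kummerSelmerStructure ((p : ℤ) ^ k * (p : ℤ)) (Sum.inr v₀))
    (D : KolyvaginDatum (W.torsionGaloisModule ((p : ℤ) ^ k * (p : ℤ))))
    {d : Finset (HeightOneSpectrum (𝓞 ℚ))} (hv₀d : v₀ ∉ d)
    {x : galoisCohomology (W.torsionGaloisModule ((p : ℤ) ^ k * (p : ℤ))) 1}
    (hx : x ∈ (D.atLevel (propagatedSelmerStructure W p k) d).selmerGroup) :
    Λ (galoisCohomology.localization _ (Sum.inr v₀) 1 x) = 0 ↔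
      x ∈ (D.atLevel (W.kummerSelmerStructure ((p : ℤ) ^ k * (p : ℤ))) d).selmerGroup := by
  rw [SelmerStructure.mem_selmerGroup_iff] at hx ⊢
  have hx₀ : galoisCohomology.localization _ (Sum.inr v₀) 1 x ∈
      propagatedSelmerStructure W p k (Sum.inr v₀) := by
    have := hx (Sum.inr v₀)
    rwa [Level.atLevel_inr_of_not_mem D _ hv₀d] at this
  constructor
  · intro h v
    rcases v with w | v
    · rw [DeepLedger.localization_inl_eq_zero W p k hp2 w x]
      exact zero_mem _
    · by_cases hv : v = v₀
      · subst hv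
        rw [Level.atLevel_inr_of_not_mem D _ hv₀d]
        exact (hker _ hx₀).1 h
      · by_cases hvd : v ∈ d
        · rw [Level.atLevel_inr_of_mem D _ hvd]
          have := hx (Sum.inr v)
          rwa [Level.atLevel_inr_of_mem D _ hvd] at this
        · have hpv : ((p : ℕ) : 𝓞 ℚ) ∉ v.asIdeal := fun h' =>
            hv (heightOneSpectrum_eq_of_natCast_mem hp.out h' hv₀)
          rw [Level.atLevel_inr_of_not_mem D _ hvd,
            ← propagatedSelmerStructure_inr_eq_kummerSelmerStructure W p k hpv]
          have := hx (Sum.inr v)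
          rwa [Level.atLevel_inr_of_not_mem D _ hvd] at this
  · intro h
    have := h (Sum.inr v₀)
    rw [Level.atLevel_inr_of_not_mem D _ hv₀d] at this
    exact (hker _ hx₀).2 this

/-- **The `hinj` clause of the END core from the vanishing of the level-`d` KUMMER Selmer group.**
If `H¹_{𝓚(d)}(ℚ, E[p^{k+1}]) = 0` at a level `d ∌ v_p`, then `Λ ∘ loc_{v_p}` is injective on
`H¹_{𝓕_can(d)}(ℚ, E[p^{k+1}])` — VERBATIM the hypothesis `hinj` of
`KimAtThreeDeepUpperEndCore.EndCore.exists_certificate_of_witnessAt` (w2-c3, p424582) for the datum `D`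
and the vertex `d`.  With §4 (the residual level `k = 0`) this is the Selmer-vanishing half of the
GOOD CORE VERTEX port of cruxes 19076/19077; at depth `k ≥ 1` the remaining step is the dévissage
`H¹_{𝓚̄(d)}(ℚ, E[p]) = 0 ⟹ H¹_{𝓚(d)}(ℚ, E[p^{k+1}]) = 0` (Mazur–Rubin Lemma 3.5.3 / the cartesian
property, Sakamoto Def. 3.5), not done here. [cite: MazurRubin2004, Prop. 2.3.5, Lemma 3.5.3, Cor. 4.1.9]
[cite: Kim2022StructureSelmer, Prop. 3.12] -/
theorem localization_injOn_atLevel_of_kummer_atLevel_eq_bot (hp2 : p ≠ 2)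
    {v₀ : HeightOneSpectrum (𝓞 ℚ)} (hv₀ : ((p : ℕ) : 𝓞 ℚ) ∈ v₀.asIdeal)
    (Λ : galoisCohomology ((W.torsionGaloisModule ((p : ℤ) ^ k * (p : ℤ))).toLocal (Sum.inr v₀)) 1
      →+ ZMod (p ^ (k + 1)))
    (hker : ∀ x ∈ propagatedSelmerStructure W p k (Sum.inr v₀),
      Λ x = 0 ↔ x ∈ W.kummerSelmerStructure ((p : ℤ) ^ k * (p : ℤ)) (Sum.inr v₀))
    (D : KolyvaginDatum (W.torsionGaloisModule ((p : ℤ) ^ k * (p : ℤ))))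
    {d : Finset (HeightOneSpectrum (𝓞 ℚ))} (hv₀d : v₀ ∉ d)
    (hbot : (D.atLevel (W.kummerSelmerStructure ((p : ℤ) ^ k * (p : ℤ))) d).selmerGroup = ⊥) :
    ∀ x ∈ (D.atLevel (propagatedSelmerStructure W p k) d).selmerGroup,
      Λ (galoisCohomology.localization _ (Sum.inr v₀) 1 x) = 0 → x = 0 := by
  intro x hx h0
  have hmem := (apply_localization_eq_zero_iff_mem_kummer_atLevel W p k hp2 hv₀ Λ hker D hv₀d hx).1 h0
  rw [hbot] at hmem
  exact (AddSubgroup.mem_bot).1 hmem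

end Depth

end Summit.BirchSwinnertonDyer.BirchSwinnertonDyer.Theorems.KimAtThreeShallowEqDeepGoodCoreVertex

end
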